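import Summits.KontsevichZagierPeriods.KontsevichZagierPeriods.Theses.GenusOneIterated
import Summits.KontsevichZagierPeriods.KontsevichZagierPeriods.Theorems.GenusOneIteratedLegendreLemniscatic

/-!
# `DepthThreeFamily` (stmt-KontsevichZagierPeriods-6776, route GenusOneIterated, crux rank 2) — line `flatframe`

Strategist line (`cstrat-stmt-KontsevichZagierPeriods-6776-s2`, 2026-08-17), an ALTERNATIVE to
`Lines/birth.lean`; it does not touch the birth skeleton or its stubs (`stub_cuspLemniscatic` is shared verbatim).

Crux (verbatim the route decl `…Theses.GenusOneIterated.DepthThreeFamily`): for every real cubic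
`y² = f(x) = 4(x−e₁)(x−e₂)(x−e₃)`, `e₃ < e₂ < e₁` real algebraic, `Σ eᵢ = 0`, and all normal-form reps
`r = I(ωωη)`, `rA = ω₁/2`, `rB = −η₁/2`, `rA' = |ω₂|/2`, `rL` (unfolded logarithms), the DEPTH-THREE DEFECT
`D₁(e) := 48[r] − 8[rA][rA][rB] + 4[π][rA'] − [rA][rL]` lies in `KZ.relations`.

## Why a second line (what the birth line cannot do)

Gauss–Manin in the modulus does NOT close on `D₁` alone.  In the normalisation `e₂ − e₃ = 1`,
`Λ = (e₁−e₃)/(e₂−e₃)`, `x = e₃ + ξ`, `ω̃ = dξ/√(ξ(1−ξ)(Λ−ξ))`, `η̃ = ξω̃`, the exact-letter calculus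
(`∂_Λ ω̃ = aω̃ + bη̃ + c·dg`, `∂_Λ η̃ = a'ω̃ + b'η̃ + c'·dg` with the ALGEBRAIC fibre primitive
`g = ỹ/(Λ−ξ)`, `g(0) = g(1) = 0`; `a = Λ/2D₀`, `b = −1/2D₀`, `c = −1/D₀`, `a' = −b' = 1/(2(1−Λ))`,
`c' = −1/(1−Λ)`, `D₀ = Λ(1−Λ)`) gives for the two Lyndon coordinates of length three
`J = Ĩ(ω̃ω̃η̃)` (the crux's `I(ωωη)`) and `J₂ = Ĩ(ω̃η̃η̃)` (the second Lyndon word `I(ωηη)`):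
`J' = (2a+b')J − b·J₂ + (length ≤ 2)`, `J₂' = (a+2b')J₂ − a'·J + (length ≤ 2)`; the dlog letter
`gω̃ = dξ/(Λ−ξ)` drops out (`cΛ − c' = 0`) and, since `a + b' = 0`, the block `(J, −J₂)` has EXACTLY the
Picard–Fuchs matrix of the periods `(A, B) = (∫ω̃, ∫η̃)` (checked numerically to 1e−9, `num/check_L123.py`).
Hence `∂_Λ D₁` contains the second-Lyndon defect `D₂` with coefficient `−b ≠ 0`: the birth stub
`stub_modulusTransport` (one Newton–Leibniz move in the modulus for `D₁` alone, fibrewise-exact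
certificate) has no certificate to find.  The coupled pair `D = (D₁, D₂)` IS transportable, but only in
the Betti-flat frame `adj(Φ)·D`, `Φ = [[rA, rA'],[rB, rB']]` the real period matrix; un-framing costs
`det Φ = rA·rB' − rB·rA' = π/2` (Legendre, real Weierstrass form).  OUTPUT OF TRANSPORT: `[π]·D₁(e) ∈
KZ.relations`, i.e. the crux LOCALISED AT `[π]`; the residual step is `π`-cancellation on the defect
class — an instance of the tree conjecture `KZ.PiCancellation` (stmt-KontsevichZagierPeriods-0540, route
AyoubSpecialisation; Huber–Wüstholz 2022 App. A.4: effective → localised injectivity, open).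

## The line (five registered stubs; composition `DepthThreeFamily_of` sorry-free)

* `stub_cuspLemniscatic` — VERBATIM route crux `DepthThreeLemniscatic` (stmt-6777) = birth's stub 1 (shared).
* `stub_secondLyndonLemniscatic` — VERBATIM route crux `SecondLyndonLemniscatic` (stmt-6779): the second
  anchor the coupled transport needs (the birth line needs it too, unacknowledged).
* `stub_framedTransport` — THE LOAD-BEARING STUB: from the two CM cruxes (by name), for every admissible
  `e` and all crux reps there EXIST a B-quasi-period rep `rB' = ∫_{e₂}^{e₁} x dx/√(−f)` and a companion
  class `Y : FormalRep` such that the two FLAT ROWS `[rB']·D₁ − [rA']·Y ∈ Rel` and `[rA]·Y − [rB]·D₁ ∈ Rel`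
  hold (`adj(Φ)·(D₁, Y)ᵀ ∈ Rel²`, `Φ = [[rA, rA'],[rB, rB']]`).  The INTENDED WITNESS is the (L2)-FAMILY
  defect `Y = D₂(e) := 24[rA][r₂] − 4[rA]²[rB]² − 2[π][rB][rA'] − [π]² − 12[rA][rB] + [rA][rB][rL₂]`,
  `r₂ = I(ωηη) = [Δ₃(e₃,e₂), x₁x₂/(y₀y₁y₂)]`, `rL₂` the unfolded `8log2 − 2log(e₁−e₃) + 4log(e₁−e₂) −
  2log(e₂−e₃)` (closed form (L2) of the route header × 48ω₁, verified to ≤ 5e−13 on five moduli); `Y` is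
  existential only to keep the registered signature short — any admissible `Y` forces `[π]·D₁ ∈ Rel`
  (stub 4), so the ∃-form is not cheaper than the transport.  The lemniscatic normal-form bookkeeping
  (`D₁(e₀)`, `D₂(e₀) ∈ Rel` from `LegendreLemniscatic` (landed) + the two CM cruxes; for `D₁` this is
  verbatim birth's `stub_lemniscaticNormalForm`, usable by name once it lands) is part of this stub.
  Plan: algebraic segment in the modulus cone; affine normalisation of every domain (rule 2); ONE
  Newton–Leibniz move in the modulus per constituent of `adj(Φ)·D` (rule 3, integrand as primitive);
  fibrewise-exact certificate = the GM identities above (rule 3 in a fibre variable, algebraic primitive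
  `g`) + shuffles + `KummerFamily` (landed) + `LegendreAllModuli` (landed, Jacobi form) in family form,
  with `∂(adjΦ·D) = adjΦ·E`, `E` in the Legendre ideal (formal, since `(J,−J₂)` and `(A,B)` share `G`).
  Size XL.  Why it might fail: the family (uniform-in-t) versions of Kummer/Legendre must be re-run with
  `t` as a coordinate; the certificate `E ∈ ⟨Legendre⟩` is a finite polynomial identity still to be
  computed (kit/CAS); integrability of `∂_t` of the normalised integrands at the torsion endpoints.
* `stub_legendreElimination` — generic, M: Legendre in real Weierstrass form at `e`
  (`2([rA][rB'] − [rB][rA']) ~ [π]`, one algebraic substitution from `LegendreAllModuli_of`) turns the two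
  flat rows into `[π]·X ∈ Rel` (`[rA]·Row₁ + [rA']·Row₂`, associativity/commutativity modulo relations:
  `KZ.mul_sub_mul_comm_mem_relations`, `KZ.of_sub_of_reindex_mem_relations`).
* `stub_piCancellationOnDefect` — `[π]·D₁(e) ∈ Rel → D₁(e) ∈ Rel`: the instance of `KZ.PiCancellation`
  (stmt-0540) on the defect class; conjecture-grade in general, the honest residual of every transport or
  cut-torus argument for this crux (see `STRATEGY-CENSUS.md`).  Sector-specific tools: route
  TerasomaMultiplication's `BetaCancellation` kit (catalytic Newton–Leibniz, fibred π-cancellation).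

Composition: the two CM anchors (stubs 1–2) feed the transport (stub 3), whose rows feed Legendre
elimination (stub 4), whose `[π]·D₁ ∈ Rel` feeds π-cancellation (stub 5) — pure logic, no algebra in
`KZ.relations` inside the composition.
Disproof used: none on file (`ledger crux ls`: only `Lines/birth.*`; no `Disproof.lean`, no
`Theorems/DepthThreeFamily/Negative/*`; `ledger negatives`: 1 unrelated entry, KinematicPlaneConvex).
All statements are over existing declarations (`Literature.NumberTheory.Transcendental.KZ.*`, the route
decls `LegendreLemniscatic`, `DepthThreeLemniscatic`, `SecondLyndonLemniscatic`, Mathlib).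
-/

set_option linter.dupNamespace false

namespace Summit.KontsevichZagierPeriods.KontsevichZagierPeriods.Cruxes.DepthThreeFamily.FlatFrame

open Summit.KontsevichZagierPeriods.KontsevichZagierPeriods.Theses.GenusOneIterated (DepthThreeFamily DepthThreeLemniscatic SecondLyndonLemniscatic LegendreLemniscatic)

/-- Stub 1 (CM ANCHOR for (L1); VERBATIM the route crux `DepthThreeLemniscatic`, stmt-KontsevichZagierPeriods-6777, and verbatim birth's stub 1): on `y² = 4x³ − 4x`, `8·I(ωωη) ~ ∫_{−1<x₀<0, 0<x₁<1} (4/(1+x₁) − 4/(1+x₁²))/y₀` (`I(ωωη) = ϖ(4 log 2 − π)/16`). θ-function evaluation + Legendre; value certified to 70 digits (refuter job j000974). Sources: arXiv:1301.3042, arXiv:1509.08760, Lawden1989 Ch. 6, Chudnovsky1976, KontsevichZagier2001 §1.2. Size XL. -/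
theorem stub_cuspLemniscatic : ∀ (r : Literature.NumberTheory.Transcendental.KZ.IntegralRep 3) (r' : Literature.NumberTheory.Transcendental.KZ.IntegralRep 2), r.domain = {x | -1 < x 0 ∧ x 0 < x 1 ∧ x 1 < x 2 ∧ x 2 < 0} → Set.EqOn r.integrand (fun x => 8 * x 2 / (Real.sqrt (4 * x 0 ^ 3 - 4 * x 0) * Real.sqrt (4 * x 1 ^ 3 - 4 * x 1) * Real.sqrt (4 * x 2 ^ 3 - 4 * x 2))) r.domain → r'.domain = {x | -1 < x 0 ∧ x 0 < 0 ∧ 0 < x 1 ∧ x 1 < 1} → Set.EqOn r'.integrand (fun x => (4 / (1 + x 1) - 4 / (1 + x 1 ^ 2)) / Real.sqrt (4 * x 0 ^ 3 - 4 * x 0)) r'.domain → Literature.NumberTheory.Transcendental.KZ.Equivalent r r' := by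
  sorry

/-- Stub 2 (CM ANCHOR for (L2); VERBATIM the route crux `SecondLyndonLemniscatic`, stmt-KontsevichZagierPeriods-6779): on `y² = 4x³ − 4x`, `16ϖ·I(ωηη) = π² + 2π log 2 − 4π`, filed as `32·[(−1,0)×Δ₃, x₂x₃/(y₀y₁y₂y₃)] ~ [(0,1)², 4/(1+u²)·(4/(1+v²) + 2/(1+v) − 4)]`. The coupled transport needs BOTH Lyndon anchors because `∂_Λ D₁ ∋ −b·D₂`. Sources: arXiv:1301.3042, arXiv:1507.02254, Lawden1989, KontsevichZagier2001 §1.2. Size XL. -/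
theorem stub_secondLyndonLemniscatic : ∀ (r : Literature.NumberTheory.Transcendental.KZ.IntegralRep 4) (r' : Literature.NumberTheory.Transcendental.KZ.IntegralRep 2), r.domain = {x | -1 < x 0 ∧ x 0 < 0 ∧ -1 < x 1 ∧ x 1 < x 2 ∧ x 2 < x 3 ∧ x 3 < 0} → Set.EqOn r.integrand (fun x => 32 * x 2 * x 3 / (Real.sqrt (4 * x 0 ^ 3 - 4 * x 0) * Real.sqrt (4 * x 1 ^ 3 - 4 * x 1) * Real.sqrt (4 * x 2 ^ 3 - 4 * x 2) * Real.sqrt (4 * x 3 ^ 3 - 4 * x 3))) r.domain → r'.domain = {x | 0 < x 0 ∧ x 0 < 1 ∧ 0 < x 1 ∧ x 1 < 1} → Set.EqOn r'.integrand (fun x => 4 / (1 + x 0 ^ 2) * (4 / (1 + x 1 ^ 2) + 2 / (1 + x 1) - 4)) r'.domain → Literature.NumberTheory.Transcendental.KZ.Equivalent r r' := by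
  sorry

/-- Stub 3 (BETTI-FLAT GAUSS–MANIN TRANSPORT OF THE COUPLED DEFECT — the load-bearing stub): from the two CM cruxes `DepthThreeLemniscatic`, `SecondLyndonLemniscatic` (by name; their lemniscatic normal forms `D₁(e₀), D₂(e₀) ∈ Rel` via the landed `legendreLemniscatic_proof` are bookkeeping inside this stub — for `D₁` verbatim birth's `stub_lemniscaticNormalForm`), for every admissible modulus `e` and all crux reps there exist a B-quasi-period rep `rB' = ∫_{e₂}^{e₁} x dx/√(−f)` and a class `Y : FormalRep` with the two FLAT ROWS `[rB']·D₁ − [rA']·Y ∈ Rel`, `[rA]·Y − [rB]·D₁ ∈ Rel` (`adj(Φ)·(D₁,Y)ᵀ`, `Φ = [[rA, rA'],[rB, rB']]`). Intended witness: the (L2)-FAMILY defect `Y = D₂(e) = 24[rA][r₂] − 4[rA]²[rB]² − 2[π][rB][rA'] − [π]² − 12[rA][rB] + [rA][rB][rL₂]`, `r₂ = I(ωηη) = [Δ₃(e₃,e₂), x₁x₂/(y₀y₁y₂)]`, `rL₂ = [(0,1), 8/(1+u) − 2(e₁−e₃−1)/(1+(e₁−e₃−1)u) + 4(e₁−e₂−1)/(1+(e₁−e₂−1)u)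 − 2(e₂−e₃−1)/(1+(e₂−e₃−1)u)]` (value `8log2 − 2log(e₁−e₃) + 4log(e₁−e₂) − 2log(e₂−e₃)`); the (L2)-family identity `24 rA·I(ωηη) − 4rA²rB² − 2π rB rA' − π² − 12 rA rB + rA rB rL₂ = 0` is verified to ≤ 5e−13 on five moduli (`num/check_L123.py`). Plan: affine normalisation of all domains (rule 2), one Newton–Leibniz move in the modulus per constituent (rule 3, integrand as semialgebraic primitive, template `stub_legendreModulusPropagation`), fibrewise-exact certificate from the exact-letter Gauss–Manin identities (rule 3 in a fibre variable with the ALGEBRAIC primitive `g = ỹ/(Λ−ξ)`), shuffles, `KummerFamily` and `LegendreAllModuli` in family form; `∂(adjΦ·D) = adjΦ·E` with `E` in the Legendre ideal because `(J, −J₂)` and `(A, B)` have the same Picard–Fuchs matrix. Why it might fail: family versions of Kummer/Legendre to be re-run with `t` as a coordinate; the polynomial certificate `E ∈ ⟨Legendre⟩` is still to be computed; endpoint integrability of `∂_t`. Sources: KontsevichZagier2001 §1.2, arXiv:1301.3042 §2.4, arXiv:1110.6917, MckeanMoll1999 §2.4; tree `LegendreAllModuli_of`, `KummerFamily_proof`.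 Size XL (+ M/L bookkeeping). -/
theorem stub_framedTransport : Summit.KontsevichZagierPeriods.KontsevichZagierPeriods.Theses.GenusOneIterated.DepthThreeLemniscatic → Summit.KontsevichZagierPeriods.KontsevichZagierPeriods.Theses.GenusOneIterated.SecondLyndonLemniscatic → ∀ (e₁ e₂ e₃ : ℝ), IsAlgebraic ℚ e₁ → IsAlgebraic ℚ e₂ → IsAlgebraic ℚ e₃ → e₃ < e₂ → e₂ < e₁ → e₁ + e₂ + e₃ = 0 → ∀ (r : Literature.NumberTheory.Transcendental.KZ.IntegralRep 3) (rA rB rA' rL : Literature.NumberTheory.Transcendental.KZ.IntegralRep 1), r.domain = {x | e₃ < x 0 ∧ x 0 < x 1 ∧ x 1 < x 2 ∧ x 2 < e₂} → Set.EqOn r.integrand (fun x => x 2 / (Real.sqrt (4 * (x 0 - e₁) * (x 0 - e₂) * (x 0 - e₃)) * Real.sqrt (4 * (x 1 - e₁) * (x 1 - e₂) * (x 1 - e₃)) * Real.sqrt (4 * (x 2 - e₁) * (x 2 - e₂) * (x 2 - e₃)))) r.domain → rA.domain = {x | e₃ < x 0 ∧ x 0 < e₂} → Set.EqOn rA.integrand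 (fun x => 1 / Real.sqrt (4 * (x 0 - e₁) * (x 0 - e₂) * (x 0 - e₃))) rA.domain → rB.domain = {x | e₃ < x 0 ∧ x 0 < e₂} → Set.EqOn rB.integrand (fun x => x 0 / Real.sqrt (4 * (x 0 - e₁) * (x 0 - e₂) * (x 0 - e₃))) rB.domain → rA'.domain = {x | e₂ < x 0 ∧ x 0 < e₁} → Set.EqOn rA'.integrand (fun x => 1 / Real.sqrt (-(4 * (x 0 - e₁) * (x 0 - e₂) * (x 0 - e₃)))) rA'.domain → rL.domain = {x | 0 < x 0 ∧ x 0 < 1} → Set.EqOn rL.integrand (fun x => 16 / (1 + x 0) + 8 * (e₁ - e₃ - 1) / (1 + (e₁ - e₃ - 1) * x 0) - 4 * (e₁ - e₂ - 1) / (1 + (e₁ - e₂ - 1) * x 0) - 4 * (e₂ - e₃ - 1) / (1 + (e₂ - e₃ - 1) * x 0)) rL.domain → ∃ (rB' : Literature.NumberTheory.Transcendental.KZ.IntegralRep 1) (Y : Literature.NumberTheory.Transcendental.KZ.FormalRep), rB'.domain = {x | e₂ < x 0 ∧ x 0 < e₁} ∧ Set.EqOn rB'.integrand (fun x => x 0 /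 Real.sqrt (-(4 * (x 0 - e₁) * (x 0 - e₂) * (x 0 - e₃)))) rB'.domain ∧ (Literature.NumberTheory.Transcendental.KZ.of rB' * (48 • Literature.NumberTheory.Transcendental.KZ.of r - 8 • (Literature.NumberTheory.Transcendental.KZ.of rA * Literature.NumberTheory.Transcendental.KZ.of rA * Literature.NumberTheory.Transcendental.KZ.of rB) + 4 • (Literature.NumberTheory.Transcendental.KZ.of Literature.NumberTheory.Transcendental.KZ.piRep * Literature.NumberTheory.Transcendental.KZ.of rA') - Literature.NumberTheory.Transcendental.KZ.of rA * Literature.NumberTheory.Transcendental.KZ.of rL) - Literature.NumberTheory.Transcendental.KZ.of rA' * Y ∈ Literature.NumberTheory.Transcendental.KZ.relations) ∧ (Literature.NumberTheory.Transcendental.KZ.of rA * Y - Literature.NumberTheory.Transcendental.KZ.of rB * (48 • Literature.NumberTheory.Transcendental.KZ.of r - 8 • (Literature.NumberTheory.Transcendental.KZ.of rA * Literature.NumberTheory.Transcendental.KZ.of rA * Literature.NumberTheory.Transcendental.KZ.of rB) + 4 • (Literature.NumberTheory.Transcendental.KZ.of Literature.NumberTheory.Transcendental.KZ.piRep * Literature.NumberTheory.Transcendental.KZ.of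 rA') - Literature.NumberTheory.Transcendental.KZ.of rA * Literature.NumberTheory.Transcendental.KZ.of rL) ∈ Literature.NumberTheory.Transcendental.KZ.relations) := by
  sorry

/-- Stub 4 (LEGENDRE ELIMINATION, generic): for reps `rA, rB` (A-side) and `rA', rB'` (B-side (quasi-)periods of the twist oval) at an admissible modulus and ANY `X Y : FormalRep`, the flat rows `[rB']X − [rA']Y ∈ Rel`, `[rA]Y − [rB]X ∈ Rel` give `[π]·X ∈ Rel`: `[rA]·Row₁ + [rA']·Row₂ ≡ ([rA][rB'] − [rA'][rB])·X` (left ideal `KZ.mul_mem_relations_left_holds`, commutativity `KZ.mul_sub_mul_comm_mem_relations`, associativity by `KZ.of_sub_of_reindex_mem_relations`) and Legendre in real Weierstrass form `2([rA][rB'] − [rB][rA']) ~ [piRep]` (`rA rB' − rB rA' = π/2`, checked to 1e−14; from the landed `LegendreAllModuli_of` by the substitution `x = e₃ + (e₂−e₃)ξ²` and its twist). Sources: KontsevichZagier2001 §1.2, WhittakerWatson1927 (Legendre's relation), MckeanMoll1999 §2.4; tree `LegendreAllModuli_of`. Size M. -/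
theorem stub_legendreElimination : ∀ (e₁ e₂ e₃ : ℝ), IsAlgebraic ℚ e₁ → IsAlgebraic ℚ e₂ → IsAlgebraic ℚ e₃ → e₃ < e₂ → e₂ < e₁ → ∀ (rA rB rA' rB' : Literature.NumberTheory.Transcendental.KZ.IntegralRep 1), rA.domain = {x | e₃ < x 0 ∧ x 0 < e₂} → Set.EqOn rA.integrand (fun x => 1 / Real.sqrt (4 * (x 0 - e₁) * (x 0 - e₂) * (x 0 - e₃))) rA.domain → rB.domain = {x | e₃ < x 0 ∧ x 0 < e₂} → Set.EqOn rB.integrand (fun x => x 0 / Real.sqrt (4 * (x 0 - e₁) * (x 0 - e₂) * (x 0 - e₃))) rB.domain → rA'.domain = {x | e₂ < x 0 ∧ x 0 < e₁} → Set.EqOn rA'.integrand (fun x => 1 / Real.sqrt (-(4 * (x 0 - e₁) * (x 0 - e₂) * (x 0 - e₃)))) rA'.domain → rB'.domain = {x | e₂ < x 0 ∧ x 0 < e₁} → Set.EqOn rB'.integrand (fun x => x 0 / Real.sqrt (-(4 * (x 0 - e₁) * (x 0 - e₂) * (x 0 - e₃)))) rB'.domain → ∀ (X Y : Literature.NumberTheory.Transcendental.KZ.FormalRep),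 Literature.NumberTheory.Transcendental.KZ.of rB' * X - Literature.NumberTheory.Transcendental.KZ.of rA' * Y ∈ Literature.NumberTheory.Transcendental.KZ.relations → Literature.NumberTheory.Transcendental.KZ.of rA * Y - Literature.NumberTheory.Transcendental.KZ.of rB * X ∈ Literature.NumberTheory.Transcendental.KZ.relations → Literature.NumberTheory.Transcendental.KZ.of Literature.NumberTheory.Transcendental.KZ.piRep * X ∈ Literature.NumberTheory.Transcendental.KZ.relations := by
  sorry

/-- Stub 5 (π-CANCELLATION ON THE DEFECT CLASS — the residual): `[π]·D₁(e) ∈ KZ.relations → D₁(e) ∈ KZ.relations`. The instance of the tree conjecture `KZ.PiCancellation` (stmt-KontsevichZagierPeriods-0540, route AyoubSpecialisation; `∀ c, [π]*c ∈ Rel → c ∈ Rel`) on the depth-three defect; discharged by `exact h0540 _` once 0540 lands; sector-specific attacks: route TerasomaMultiplication's BetaCancellation toolkit (catalytic Newton–Leibniz, fibred π-cancellation). Conjecture-grade in general (Huber–Wüstholz 2022, App. A.4: effective → localised injectivity is open; Ayoub 2015 Rem. 1.3). Sources: KontsevichZagier2001 §4.1, HuberWustholz2022 App. A. Size: open. 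-/
theorem stub_piCancellationOnDefect : ∀ (e₁ e₂ e₃ : ℝ), IsAlgebraic ℚ e₁ → IsAlgebraic ℚ e₂ → IsAlgebraic ℚ e₃ → e₃ < e₂ → e₂ < e₁ → e₁ + e₂ + e₃ = 0 → ∀ (r : Literature.NumberTheory.Transcendental.KZ.IntegralRep 3) (rA rB rA' rL : Literature.NumberTheory.Transcendental.KZ.IntegralRep 1), r.domain = {x | e₃ < x 0 ∧ x 0 < x 1 ∧ x 1 < x 2 ∧ x 2 < e₂} → Set.EqOn r.integrand (fun x => x 2 / (Real.sqrt (4 * (x 0 - e₁) * (x 0 - e₂) * (x 0 - e₃)) * Real.sqrt (4 * (x 1 - e₁) * (x 1 - e₂) * (x 1 - e₃)) * Real.sqrt (4 * (x 2 - e₁) * (x 2 - e₂) * (x 2 - e₃)))) r.domain → rA.domain = {x | e₃ < x 0 ∧ x 0 < e₂} → Set.EqOn rA.integrand (fun x => 1 / Real.sqrt (4 * (x 0 - e₁) * (x 0 - e₂) * (x 0 - e₃))) rA.domain → rB.domain = {x | e₃ < x 0 ∧ x 0 < e₂} → Set.EqOn rB.integrand (fun x => x 0 / Real.sqrt (4 *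 (x 0 - e₁) * (x 0 - e₂) * (x 0 - e₃))) rB.domain → rA'.domain = {x | e₂ < x 0 ∧ x 0 < e₁} → Set.EqOn rA'.integrand (fun x => 1 / Real.sqrt (-(4 * (x 0 - e₁) * (x 0 - e₂) * (x 0 - e₃)))) rA'.domain → rL.domain = {x | 0 < x 0 ∧ x 0 < 1} → Set.EqOn rL.integrand (fun x => 16 / (1 + x 0) + 8 * (e₁ - e₃ - 1) / (1 + (e₁ - e₃ - 1) * x 0) - 4 * (e₁ - e₂ - 1) / (1 + (e₁ - e₂ - 1) * x 0) - 4 * (e₂ - e₃ - 1) / (1 + (e₂ - e₃ - 1) * x 0)) rL.domain → Literature.NumberTheory.Transcendental.KZ.of Literature.NumberTheory.Transcendental.KZ.piRep * (48 • Literature.NumberTheory.Transcendental.KZ.of r - 8 • (Literature.NumberTheory.Transcendental.KZ.of rA * Literature.NumberTheory.Transcendental.KZ.of rA * Literature.NumberTheory.Transcendental.KZ.of rB) + 4 • (Literature.NumberTheory.Transcendental.KZ.of Literature.NumberTheory.Transcendental.KZ.piRep * Literature.NumberTheory.Transcendental.KZ.of rA') - Literature.NumberTheory.Transcendental.KZ.of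 rA * Literature.NumberTheory.Transcendental.KZ.of rL) ∈ Literature.NumberTheory.Transcendental.KZ.relations → 48 • Literature.NumberTheory.Transcendental.KZ.of r - 8 • (Literature.NumberTheory.Transcendental.KZ.of rA * Literature.NumberTheory.Transcendental.KZ.of rA * Literature.NumberTheory.Transcendental.KZ.of rB) + 4 • (Literature.NumberTheory.Transcendental.KZ.of Literature.NumberTheory.Transcendental.KZ.piRep * Literature.NumberTheory.Transcendental.KZ.of rA') - Literature.NumberTheory.Transcendental.KZ.of rA * Literature.NumberTheory.Transcendental.KZ.of rL ∈ Literature.NumberTheory.Transcendental.KZ.relations := by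
  sorry

/-! ## The composition (sorry-free) -/

/-- **Skeleton theorem, arrow form** (concludes the crux BY NAME): two CM anchors → their normal forms →
Betti-flat transport → Legendre elimination → π-cancellation → `DepthThreeFamily`. Pure logic. [folklore] -/
theorem DepthThreeFamily_of :
    (∀ (r : Literature.NumberTheory.Transcendental.KZ.IntegralRep 3) (r' : Literature.NumberTheory.Transcendental.KZ.IntegralRep 2), r.domain = {x | -1 < x 0 ∧ x 0 < x 1 ∧ x 1 < x 2 ∧ x 2 < 0} → Set.EqOn r.integrand (fun x => 8 * x 2 / (Real.sqrt (4 * x 0 ^ 3 - 4 * x 0) * Real.sqrt (4 * x 1 ^ 3 - 4 * x 1) * Real.sqrt (4 * x 2 ^ 3 - 4 * x 2))) r.domain → r'.domain = {x | -1 < x 0 ∧ x 0 < 0 ∧ 0 < x 1 ∧ x 1 < 1} → Set.EqOn r'.integrand (fun x => (4 / (1 + x 1) - 4 / (1 + x 1 ^ 2)) / Real.sqrt (4 * x 0 ^ 3 - 4 * x 0)) r'.domain → Literature.NumberTheory.Transcendental.KZ.Equivalent r r') →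
    (∀ (r : Literature.NumberTheory.Transcendental.KZ.IntegralRep 4) (r' : Literature.NumberTheory.Transcendental.KZ.IntegralRep 2), r.domain = {x | -1 < x 0 ∧ x 0 < 0 ∧ -1 < x 1 ∧ x 1 < x 2 ∧ x 2 < x 3 ∧ x 3 < 0} → Set.EqOn r.integrand (fun x => 32 * x 2 * x 3 / (Real.sqrt (4 * x 0 ^ 3 - 4 * x 0) * Real.sqrt (4 * x 1 ^ 3 - 4 * x 1) * Real.sqrt (4 * x 2 ^ 3 - 4 * x 2) * Real.sqrt (4 * x 3 ^ 3 - 4 * x 3))) r.domain → r'.domain = {x | 0 < x 0 ∧ x 0 < 1 ∧ 0 < x 1 ∧ x 1 < 1} → Set.EqOn r'.integrand (fun x => 4 / (1 + x 0 ^ 2) * (4 / (1 + x 1 ^ 2) + 2 / (1 + x 1) - 4)) r'.domain → Literature.NumberTheory.Transcendental.KZ.Equivalent r r') →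
    (Summit.KontsevichZagierPeriods.KontsevichZagierPeriods.Theses.GenusOneIterated.DepthThreeLemniscatic → Summit.KontsevichZagierPeriods.KontsevichZagierPeriods.Theses.GenusOneIterated.SecondLyndonLemniscatic → ∀ (e₁ e₂ e₃ : ℝ), IsAlgebraic ℚ e₁ → IsAlgebraic ℚ e₂ → IsAlgebraic ℚ e₃ → e₃ < e₂ → e₂ < e₁ → e₁ + e₂ + e₃ = 0 → ∀ (r : Literature.NumberTheory.Transcendental.KZ.IntegralRep 3) (rA rB rA' rL : Literature.NumberTheory.Transcendental.KZ.IntegralRep 1), r.domain = {x | e₃ < x 0 ∧ x 0 < x 1 ∧ x 1 < x 2 ∧ x 2 < e₂} → Set.EqOn r.integrand (fun x => x 2 / (Real.sqrt (4 * (x 0 - e₁) * (x 0 - e₂) * (x 0 - e₃)) * Real.sqrt (4 * (x 1 - e₁) * (x 1 - e₂) * (x 1 - e₃)) * Real.sqrt (4 * (x 2 - e₁) * (x 2 - e₂) * (x 2 - e₃)))) r.domain → rA.domain = {x | e₃ < x 0 ∧ x 0 < e₂} → Set.EqOn rA.integrand (fun x => 1 / Real.sqrt (4 * (x 0 - e₁)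 * (x 0 - e₂) * (x 0 - e₃))) rA.domain → rB.domain = {x | e₃ < x 0 ∧ x 0 < e₂} → Set.EqOn rB.integrand (fun x => x 0 / Real.sqrt (4 * (x 0 - e₁) * (x 0 - e₂) * (x 0 - e₃))) rB.domain → rA'.domain = {x | e₂ < x 0 ∧ x 0 < e₁} → Set.EqOn rA'.integrand (fun x => 1 / Real.sqrt (-(4 * (x 0 - e₁) * (x 0 - e₂) * (x 0 - e₃)))) rA'.domain → rL.domain = {x | 0 < x 0 ∧ x 0 < 1} → Set.EqOn rL.integrand (fun x => 16 / (1 + x 0) + 8 * (e₁ - e₃ - 1) / (1 + (e₁ - e₃ - 1) * x 0) - 4 * (e₁ - e₂ - 1) / (1 + (e₁ - e₂ - 1) * x 0) - 4 * (e₂ - e₃ - 1) / (1 + (e₂ - e₃ - 1) * x 0)) rL.domain → ∃ (rB' : Literature.NumberTheory.Transcendental.KZ.IntegralRep 1) (Y : Literature.NumberTheory.Transcendental.KZ.FormalRep), rB'.domain = {x | e₂ < x 0 ∧ x 0 < e₁} ∧ Set.EqOn rB'.integrand (fun x => x 0 / Real.sqrt (-(4 * (x 0 - e₁) * (x 0 -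 e₂) * (x 0 - e₃)))) rB'.domain ∧ (Literature.NumberTheory.Transcendental.KZ.of rB' * (48 • Literature.NumberTheory.Transcendental.KZ.of r - 8 • (Literature.NumberTheory.Transcendental.KZ.of rA * Literature.NumberTheory.Transcendental.KZ.of rA * Literature.NumberTheory.Transcendental.KZ.of rB) + 4 • (Literature.NumberTheory.Transcendental.KZ.of Literature.NumberTheory.Transcendental.KZ.piRep * Literature.NumberTheory.Transcendental.KZ.of rA') - Literature.NumberTheory.Transcendental.KZ.of rA * Literature.NumberTheory.Transcendental.KZ.of rL) - Literature.NumberTheory.Transcendental.KZ.of rA' * Y ∈ Literature.NumberTheory.Transcendental.KZ.relations) ∧ (Literature.NumberTheory.Transcendental.KZ.of rA * Y - Literature.NumberTheory.Transcendental.KZ.of rB * (48 • Literature.NumberTheory.Transcendental.KZ.of r - 8 • (Literature.NumberTheory.Transcendental.KZ.of rA * Literature.NumberTheory.Transcendental.KZ.of rA * Literature.NumberTheory.Transcendental.KZ.of rB) + 4 • (Literature.NumberTheory.Transcendental.KZ.of Literature.NumberTheory.Transcendental.KZ.piRep * Literature.NumberTheory.Transcendental.KZ.of rA') - Literature.NumberTheory.Transcendental.KZ.of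 rA * Literature.NumberTheory.Transcendental.KZ.of rL) ∈ Literature.NumberTheory.Transcendental.KZ.relations)) →
    (∀ (e₁ e₂ e₃ : ℝ), IsAlgebraic ℚ e₁ → IsAlgebraic ℚ e₂ → IsAlgebraic ℚ e₃ → e₃ < e₂ → e₂ < e₁ → ∀ (rA rB rA' rB' : Literature.NumberTheory.Transcendental.KZ.IntegralRep 1), rA.domain = {x | e₃ < x 0 ∧ x 0 < e₂} → Set.EqOn rA.integrand (fun x => 1 / Real.sqrt (4 * (x 0 - e₁) * (x 0 - e₂) * (x 0 - e₃))) rA.domain → rB.domain = {x | e₃ < x 0 ∧ x 0 < e₂} → Set.EqOn rB.integrand (fun x => x 0 / Real.sqrt (4 * (x 0 - e₁) * (x 0 - e₂) * (x 0 - e₃))) rB.domain → rA'.domain = {x | e₂ < x 0 ∧ x 0 < e₁} → Set.EqOn rA'.integrand (fun x => 1 / Real.sqrt (-(4 * (x 0 - e₁) * (x 0 - e₂) * (x 0 - e₃)))) rA'.domain → rB'.domain = {x | e₂ < x 0 ∧ x 0 < e₁} → Set.EqOn rB'.integrand (fun x => x 0 / Real.sqrt (-(4 * (x 0 - e₁)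 * (x 0 - e₂) * (x 0 - e₃)))) rB'.domain → ∀ (X Y : Literature.NumberTheory.Transcendental.KZ.FormalRep), Literature.NumberTheory.Transcendental.KZ.of rB' * X - Literature.NumberTheory.Transcendental.KZ.of rA' * Y ∈ Literature.NumberTheory.Transcendental.KZ.relations → Literature.NumberTheory.Transcendental.KZ.of rA * Y - Literature.NumberTheory.Transcendental.KZ.of rB * X ∈ Literature.NumberTheory.Transcendental.KZ.relations → Literature.NumberTheory.Transcendental.KZ.of Literature.NumberTheory.Transcendental.KZ.piRep * X ∈ Literature.NumberTheory.Transcendental.KZ.relations) →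
    (∀ (e₁ e₂ e₃ : ℝ), IsAlgebraic ℚ e₁ → IsAlgebraic ℚ e₂ → IsAlgebraic ℚ e₃ → e₃ < e₂ → e₂ < e₁ → e₁ + e₂ + e₃ = 0 → ∀ (r : Literature.NumberTheory.Transcendental.KZ.IntegralRep 3) (rA rB rA' rL : Literature.NumberTheory.Transcendental.KZ.IntegralRep 1), r.domain = {x | e₃ < x 0 ∧ x 0 < x 1 ∧ x 1 < x 2 ∧ x 2 < e₂} → Set.EqOn r.integrand (fun x => x 2 / (Real.sqrt (4 * (x 0 - e₁) * (x 0 - e₂) * (x 0 - e₃)) * Real.sqrt (4 * (x 1 - e₁) * (x 1 - e₂) * (x 1 - e₃)) * Real.sqrt (4 * (x 2 - e₁) * (x 2 - e₂) * (x 2 - e₃)))) r.domain → rA.domain = {x | e₃ < x 0 ∧ x 0 < e₂} → Set.EqOn rA.integrand (fun x => 1 / Real.sqrt (4 * (x 0 - e₁) * (x 0 - e₂) * (x 0 - e₃))) rA.domain → rB.domain = {x | e₃ < x 0 ∧ x 0 < e₂} → Set.EqOn rB.integrand (fun x => x 0 / Real.sqrt (4 * (x 0 - e₁) * (x 0 -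 e₂) * (x 0 - e₃))) rB.domain → rA'.domain = {x | e₂ < x 0 ∧ x 0 < e₁} → Set.EqOn rA'.integrand (fun x => 1 / Real.sqrt (-(4 * (x 0 - e₁) * (x 0 - e₂) * (x 0 - e₃)))) rA'.domain → rL.domain = {x | 0 < x 0 ∧ x 0 < 1} → Set.EqOn rL.integrand (fun x => 16 / (1 + x 0) + 8 * (e₁ - e₃ - 1) / (1 + (e₁ - e₃ - 1) * x 0) - 4 * (e₁ - e₂ - 1) / (1 + (e₁ - e₂ - 1) * x 0) - 4 * (e₂ - e₃ - 1) / (1 + (e₂ - e₃ - 1) * x 0)) rL.domain → Literature.NumberTheory.Transcendental.KZ.of Literature.NumberTheory.Transcendental.KZ.piRep * (48 • Literature.NumberTheory.Transcendental.KZ.of r - 8 • (Literature.NumberTheory.Transcendental.KZ.of rA * Literature.NumberTheory.Transcendental.KZ.of rA * Literature.NumberTheory.Transcendental.KZ.of rB) + 4 • (Literature.NumberTheory.Transcendental.KZ.of Literature.NumberTheory.Transcendental.KZ.piRep * Literature.NumberTheory.Transcendental.KZ.of rA') - Literature.NumberTheory.Transcendental.KZ.of rA * Literature.NumberTheory.Transcendental.KZ.of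 rL) ∈ Literature.NumberTheory.Transcendental.KZ.relations → 48 • Literature.NumberTheory.Transcendental.KZ.of r - 8 • (Literature.NumberTheory.Transcendental.KZ.of rA * Literature.NumberTheory.Transcendental.KZ.of rA * Literature.NumberTheory.Transcendental.KZ.of rB) + 4 • (Literature.NumberTheory.Transcendental.KZ.of Literature.NumberTheory.Transcendental.KZ.piRep * Literature.NumberTheory.Transcendental.KZ.of rA') - Literature.NumberTheory.Transcendental.KZ.of rA * Literature.NumberTheory.Transcendental.KZ.of rL ∈ Literature.NumberTheory.Transcendental.KZ.relations) →
    DepthThreeFamily := by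
  intro hC1 hC2 hT hE hP e₁ e₂ e₃ ha₁ ha₂ ha₃ h₃₂ h₂₁ hsum r rA rB rA' rL h1 h2 h3 h4 h5 h6 h7 h8 h9 h10
  obtain ⟨rB', Y, g1, g2, hRow1, hRow2⟩ :=
    hT hC1 hC2 e₁ e₂ e₃ ha₁ ha₂ ha₃ h₃₂ h₂₁ hsum r rA rB rA' rL h1 h2 h3 h4 h5 h6 h7 h8 h9 h10
  have hπ := hE e₁ e₂ e₃ ha₁ ha₂ ha₃ h₃₂ h₂₁ rA rB rA' rB' h3 h4 h5 h6 h7 h8 g1 g2 _ Y hRow1 hRow2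
  exact hP e₁ e₂ e₃ ha₁ ha₂ ha₃ h₃₂ h₂₁ hsum r rA rB rA' rL h1 h2 h3 h4 h5 h6 h7 h8 h9 h10 hπ

/-- **Skeleton theorem, by name**: `DepthThreeFamily` from the five declared stubs. -/
theorem DepthThreeFamily_skeleton : DepthThreeFamily :=
  DepthThreeFamily_of stub_cuspLemniscatic stub_secondLyndonLemniscatic stub_framedTransport
    stub_legendreElimination stub_piCancellationOnDefect

end Summit.KontsevichZagierPeriods.KontsevichZagierPeriods.Cruxes.DepthThreeFamily.FlatFrame
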